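import Summits.QuantumFields.YangMills.Theses.VirialFluxGap
import Summits.QuantumFields.YangMills.Theorems.QuantileBitPuritySectors
import HarnessLib

/-!
# `VirialFluxGap.SectorWeightSmooth` (item stmt-QuantumFields-24143): the electric-flux sector weights `b ↦ W_z(b)` of the `SU(2)` ring of
# transfer kernels are differentiable and strictly positive in the coupling

Support item (S) of route `VirialFluxGap` (seat ym-idea-4, LINE g14-A, DRAFT by design → `FluxSectorLaplace.FluxSectorSuppression` ⟨24079⟩):
for every spatial torus `(ℤ/L)³`, ring length `n+1` and seam twist `z ∈ (ℤ/2)³`, the sector weight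
`W_z(b) = TT.sectorWeight b n z 1` is differentiable on `ℝ` and `> 0`.

Mechanism (calculus bookkeeping): every transfer kernel is a raw exponential `K_b(U,V) = exp(b·ψ(U,V))`, `ψ = log K_1` bounded (`K_1` is
bounded above and below by positive constants, ✓`exists_transferKernel_le` / ✓`exists_pos_le_transferKernel`); by ym-dw-p1's one-integral form
✓`TT.sectorWeight_eq_integral_prod`, `W_z(b) = ∫ exp(b·Φ_z) d(slices ⊗ seam field)` with `Φ_z = Σ_i ψ(U_i,U_{i+1}) + ψ(U_n, g·tw_z U_0)` bounded
measurable; §1 proves the generic DOMINATED DIFFERENTIATION `d/dt ∫ e^{tΦ} dν = ∫ Φ e^{tΦ} dν` for bounded measurable `Φ` on a finite measure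
(Mathlib `hasDerivAt_integral_of_dominated_loc_of_deriv_le` on the unit ball around `t₀`) and positivity `∫ e^{tΦ} dν ≥ e^{−|t|B}·ν(univ) > 0`.

HONEST FRAMING: an S support (smoothness/positivity); the cruxes `PeriodicSoftness` ⟨24141⟩ / `TwistedEquipartition` ⟨24142⟩ are NOT touched; no
rung / summit statement is proved; the YM mass gap is NOT proved (width seat ym-line-sfw-p2-w3 g35 of cell ym-idea-1, free hands).  THEOREMS ONLY
(0 `def`, 0 `sorry`), standard axioms.  References: [cite: MontvayMunster1994, (3.145)]; [cite: Luscher1983, §2].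
-/

set_option autoImplicit false

noncomputable section

open MeasureTheory Filter Set Function
open scoped BigOperators Topology
open Literature.MathematicalPhysics.QuantumFieldTheory hiding SU2


namespace Summit.QuantumFields.YangMills.Theorems.FemtoTransferGap.TT.SectorSmooth

open Summit.QuantumFields.YangMills.Theorems.FemtoTransferGap
open Summit.QuantumFields.YangMills.Theorems.FemtoTransferGap.TT
open Summit.QuantumFields.YangMills.Theorems.FemtoTransferGap.TwoLattice.TowerA (measurable_seamWeight_uncurry)

/-! ## §1 Dominated differentiation of `t ↦ ∫ e^{tΦ} dν` for bounded `Φ` -/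

section Parametric

variable {Ω : Type*} [MeasurableSpace Ω] (ν : Measure Ω) [IsFiniteMeasure ν] {Φ : Ω → ℝ} {B : ℝ}

/-- ★ **Differentiation under the integral sign for exponential tilts**: for bounded measurable `Φ` (`|Φ| ≤ B`) on a finite measure,
`t ↦ ∫ e^{tΦ} dν` has derivative `∫ Φ e^{t₀Φ} dν` at every `t₀` (dominate `|Φ e^{tΦ}| ≤ B e^{(|t₀|+1)B}` on the unit ball around `t₀`). [folklore] -/
theorem hasDerivAt_integral_exp_mul (hΦ : Measurable Φ) (hB : ∀ ω, |Φ ω| ≤ B) (t₀ : ℝ) :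
    HasDerivAt (fun t : ℝ => ∫ ω, Real.exp (t * Φ ω) ∂ν) (∫ ω, Φ ω * Real.exp (t₀ * Φ ω) ∂ν) t₀ := by
  set F : ℝ → Ω → ℝ := fun t ω => Real.exp (t * Φ ω) with hF
  set F' : ℝ → Ω → ℝ := fun t ω => Φ ω * Real.exp (t * Φ ω) with hF'
  have hmeasF : ∀ t, AEStronglyMeasurable (F t) ν := fun t =>
    ((measurable_const.mul hΦ).exp).aestronglyMeasurable
  have hmeasF' : ∀ t, AEStronglyMeasurable (F' t) ν := fun t =>
    (hΦ.mul ((measurable_const.mul hΦ).exp)).aestronglyMeasurable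
  -- `e^{tΦ} ≤ e^{(|t₀|+1) B}` on the unit ball around `t₀`
  have hexp : ∀ ω, ∀ t : ℝ, |t - t₀| ≤ 1 → Real.exp (t * Φ ω) ≤ Real.exp ((|t₀| + 1) * B) := by
    intro ω t ht
    have hB0 : 0 ≤ B := (abs_nonneg _).trans (hB ω)
    have ht1 : |t| ≤ |t₀| + 1 := by
      have := abs_sub_abs_le_abs_sub t t₀; linarith
    refine Real.exp_le_exp.2 ?_
    calc t * Φ ω ≤ |t * Φ ω| := le_abs_self _
      _ = |t| * |Φ ω| := abs_mul _ _
      _ ≤ (|t₀| + 1) * B := mul_le_mul ht1 (hB ω) (abs_nonneg _) (by positivity)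
  have hFint : Integrable (F t₀) ν := by
    refine Integrable.of_bound (hmeasF t₀) (Real.exp ((|t₀| + 1) * B)) (ae_of_all _ fun ω => ?_)
    rw [Real.norm_eq_abs, Real.abs_exp]
    exact hexp ω t₀ (by simp)
  have hbound : ∀ᵐ ω ∂ν, ∀ t ∈ Metric.ball t₀ 1, ‖F' t ω‖ ≤ B * Real.exp ((|t₀| + 1) * B) := by
    refine ae_of_all _ fun ω t ht => ?_
    rw [Metric.mem_ball, Real.dist_eq] at ht
    simp only [hF', Real.norm_eq_abs, abs_mul, Real.abs_exp]
    exact mul_le_mul (hB ω) (hexp ω t ht.le) (Real.exp_pos _).le ((abs_nonneg _).trans (hB ω))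
  have hdiff : ∀ᵐ ω ∂ν, ∀ t ∈ Metric.ball t₀ 1, HasDerivAt (F · ω) (F' t ω) t := by
    refine ae_of_all _ fun ω t _ => ?_
    simp only [hF, hF']
    have h := ((hasDerivAt_id t).mul_const (Φ ω)).exp
    simpa [mul_comm] using h
  exact (hasDerivAt_integral_of_dominated_loc_of_deriv_le (Metric.ball_mem_nhds t₀ zero_lt_one)
    (Eventually.of_forall hmeasF) hFint (hmeasF' t₀) hbound (integrable_const _) hdiff).2

/-- `t ↦ ∫ e^{tΦ} dν` is differentiable on `ℝ` (bounded measurable `Φ`, finite `ν`). [folklore] -/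
theorem differentiable_integral_exp_mul (hΦ : Measurable Φ) (hB : ∀ ω, |Φ ω| ≤ B) :
    Differentiable ℝ (fun t : ℝ => ∫ ω, Real.exp (t * Φ ω) ∂ν) := fun t =>
  (hasDerivAt_integral_exp_mul ν hΦ hB t).differentiableAt

/-- `∫ e^{tΦ} dν ≥ e^{−|t|B}·ν(univ) > 0` when `ν ≠ 0` (bounded measurable `Φ`). [folklore] -/
theorem integral_exp_mul_pos [NeZero ν] (hΦ : Measurable Φ) (hB : ∀ ω, |Φ ω| ≤ B) (t : ℝ) :
    0 < ∫ ω, Real.exp (t * Φ ω) ∂ν := by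
  have hlow : ∀ ω, Real.exp (-(|t| * B)) ≤ Real.exp (t * Φ ω) := fun ω => Real.exp_le_exp.2 (by
    have h1 : |t * Φ ω| ≤ |t| * B := by
      rw [abs_mul]; exact mul_le_mul_of_nonneg_left (hB ω) (abs_nonneg _)
    have := (abs_le.1 h1).1
    linarith)
  have hup : ∀ ω, Real.exp (t * Φ ω) ≤ Real.exp (|t| * B) := fun ω => Real.exp_le_exp.2 (by
    have h1 : |t * Φ ω| ≤ |t| * B := by
      rw [abs_mul]; exact mul_le_mul_of_nonneg_left (hB ω) (abs_nonneg _)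
    exact (abs_le.1 h1).2)
  have hint : Integrable (fun ω => Real.exp (t * Φ ω)) ν :=
    Integrable.of_bound ((measurable_const.mul hΦ).exp).aestronglyMeasurable (Real.exp (|t| * B))
      (ae_of_all _ fun ω => by rw [Real.norm_eq_abs, Real.abs_exp]; exact hup ω)
  have hpos : 0 < ν.real Set.univ := by
    rw [measureReal_def]
    exact ENNReal.toReal_pos (NeZero.ne _) (measure_ne_top _ _)
  calc (0 : ℝ) < Real.exp (-(|t| * B)) * ν.real Set.univ := mul_pos (Real.exp_pos _) hpos
    _ = ∫ _ω, Real.exp (-(|t| * B)) ∂ν := by rw [integral_const, smul_eq_mul, mul_comm]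
    _ ≤ ∫ ω, Real.exp (t * Φ ω) ∂ν := integral_mono (integrable_const _) hint hlow

end Parametric

/-! ## §2 The transfer kernel as a raw exponential `K_b = e^{bψ}`, `ψ = log K_1` bounded -/

section Kernel

variable {L : ℕ} [NeZero L]

/-- `K_b(U,V) = exp(b·ψ(U,V))` with `ψ(U,V) = log K_1(U,V) = Σₑ Re tr(UₑVₑ⁻¹) − ½(S(U)+S(V))`. [cite: Luscher1983, §2] -/
theorem transferKernel_eq_exp_mul_log (b : ℝ) (U V : GaugeConfig 3 L SU2) :
    transferKernel su2Rep b U V = Real.exp (b * Real.log (transferKernel su2Rep 1 U V)) := by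
  unfold transferKernel
  rw [Real.log_exp]
  congr 1; ring

/-- `ψ = log K_1` is bounded: `|ψ| ≤ B` for some `B`. [folklore] -/
theorem exists_abs_log_transferKernel_one_le :
    ∃ B : ℝ, ∀ U V : GaugeConfig 3 L SU2, |Real.log (transferKernel su2Rep 1 U V)| ≤ B := by
  obtain ⟨M, hM⟩ := exists_transferKernel_le su2Rep continuous_su2Rep (1 : ℝ) (L := L)
  obtain ⟨m, hm, hmK⟩ := exists_pos_le_transferKernel su2Rep continuous_su2Rep (1 : ℝ) (L := L)
  refine ⟨max |Real.log M| |Real.log m|, fun U V => ?_⟩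
  have hK := transferKernel_pos su2Rep (1 : ℝ) U V
  have h1 : Real.log (transferKernel su2Rep 1 U V) ≤ Real.log M := Real.log_le_log hK (hM U V)
  have h2 : Real.log m ≤ Real.log (transferKernel su2Rep 1 U V) := Real.log_le_log hm (hmK U V)
  rw [abs_le]
  constructor
  · have := neg_abs_le (Real.log m)
    have := le_max_right |Real.log M| |Real.log m|
    linarith
  · exact (h1.trans (le_abs_self _)).trans (le_max_left _ _)

end Kernel

/-! ## §3 The sector weights as exponential tilts: differentiability and positivity -/

section Sector

variable {L : ℕ} [NeZero L]

/-- The logarithm of the seam-closed chain at `b = 1` is the sum of the link-pair exponents: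
`log(∏ K_1 · K_1(seam)) = Σ_i ψ(U_i,U_{i+1}) + ψ(U_n, g·tw_z U_0)`. [folklore] -/
theorem log_seamChain_one (n : ℕ) (z : Fin 3 → Bool) (p : (Fin (n + 1) → GaugeConfig 3 L SU2) × (Site 3 L → SU2)) :
    Real.log ((∏ i : Fin n, transferKernel su2Rep 1 (p.1 i.castSucc) (p.1 i.succ)) *
        transferKernel su2Rep 1 (p.1 (Fin.last n)) (gaugeTransform p.2 (twist3 z (p.1 0)))) =
      (∑ i : Fin n, Real.log (transferKernel su2Rep 1 (p.1 i.castSucc) (p.1 i.succ))) +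
        Real.log (transferKernel su2Rep 1 (p.1 (Fin.last n)) (gaugeTransform p.2 (twist3 z (p.1 0)))) := by
  rw [Real.log_mul (Finset.prod_pos fun i _ => transferKernel_pos su2Rep (1 : ℝ) _ _).ne' (transferKernel_pos su2Rep (1 : ℝ) _ _).ne',
    Real.log_prod fun i _ => (transferKernel_pos su2Rep (1 : ℝ) _ _).ne']

/-- ★ **One-exponential form of the sector weight**: `W_z(b) = ∫ exp(b·Φ_z) d(slices ⊗ seam field)`, `Φ_z = log(∏ K_1 · K_1(seam))`
(`= Σ_{i<n} ψ(U_i, U_{i+1}) + ψ(U_n, g·tw_z U_0)`, `log_seamChain_one`). [cite: MontvayMunster1994, (3.145)] -/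
theorem sectorWeight_one_eq_integral_exp (b : ℝ) (n : ℕ) (z : Fin 3 → Bool) :
    sectorWeight (L := L) b n z (fun _ _ => (1 : ℝ)) =
      ∫ p : (Fin (n + 1) → GaugeConfig 3 L SU2) × (Site 3 L → SU2),
        Real.exp (b * Real.log ((∏ i : Fin n, transferKernel su2Rep 1 (p.1 i.castSucc) (p.1 i.succ)) *
          transferKernel su2Rep 1 (p.1 (Fin.last n)) (gaugeTransform p.2 (twist3 z (p.1 0)))))
        ∂((Measure.pi fun _ : Fin (n + 1) => configMeasure SU2 L).prod (gaugeMeasure L)) := by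
  rw [sectorWeight_eq_integral_prod b n z (F := fun _ _ => (1 : ℝ)) measurable_const (C := 1) (fun _ _ => by simp)]
  refine integral_congr_ae (ae_of_all _ fun p => ?_)
  simp only [mul_one]
  rw [log_seamChain_one, mul_add, Real.exp_add, Finset.mul_sum, Real.exp_sum]
  congr 1
  · exact Finset.prod_congr rfl fun i _ => transferKernel_eq_exp_mul_log b _ _
  · exact transferKernel_eq_exp_mul_log b _ _

/-- The exponent `Φ_z` is measurable (logarithm of the measurable seam-closed chain ✓`measurable_seamWeight_uncurry`). [folklore] -/
theorem measurable_sectorExponent (n : ℕ) (z : Fin 3 → Bool) :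
    Measurable fun p : (Fin (n + 1) → GaugeConfig 3 L SU2) × (Site 3 L → SU2) =>
      Real.log ((∏ i : Fin n, transferKernel su2Rep 1 (p.1 i.castSucc) (p.1 i.succ)) *
        transferKernel su2Rep 1 (p.1 (Fin.last n)) (gaugeTransform p.2 (twist3 z (p.1 0)))) :=
  (measurable_seamWeight_uncurry (L := L) 1 z n).log

/-- The exponent `Φ_z` is bounded: `|Φ_z| ≤ (n+1)·B` with `B` the bound of `ψ`. [folklore] -/
theorem exists_abs_sectorExponent_le (n : ℕ) (z : Fin 3 → Bool) :
    ∃ B : ℝ, ∀ p : (Fin (n + 1) → GaugeConfig 3 L SU2) × (Site 3 L → SU2),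
      |Real.log ((∏ i : Fin n, transferKernel su2Rep 1 (p.1 i.castSucc) (p.1 i.succ)) *
        transferKernel su2Rep 1 (p.1 (Fin.last n)) (gaugeTransform p.2 (twist3 z (p.1 0))))| ≤ B := by
  obtain ⟨B, hB⟩ := exists_abs_log_transferKernel_one_le (L := L)
  refine ⟨n * B + B, fun p => ?_⟩
  rw [log_seamChain_one]
  refine (abs_add_le _ _).trans (add_le_add ?_ (hB _ _))
  calc |∑ i : Fin n, Real.log (transferKernel su2Rep 1 (p.1 i.castSucc) (p.1 i.succ))|
      ≤ ∑ i : Fin n, |Real.log (transferKernel su2Rep 1 (p.1 i.castSucc) (p.1 i.succ))| := Finset.abs_sum_le_sum_abs _ _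
    _ ≤ ∑ _i : Fin n, B := Finset.sum_le_sum fun i _ => hB _ _
    _ = n * B := by rw [Finset.sum_const, Finset.card_univ, Fintype.card_fin, nsmul_eq_mul]

/-- ★ **The sector weights are differentiable in the coupling.** [cite: MontvayMunster1994, (3.145)] -/
theorem differentiable_sectorWeight_one (n : ℕ) (z : Fin 3 → Bool) :
    Differentiable ℝ (fun b : ℝ => sectorWeight (L := L) b n z (fun _ _ => (1 : ℝ))) := by
  haveI := isProbabilityMeasure_gaugeMeasure (L := L)
  obtain ⟨B, hB⟩ := exists_abs_sectorExponent_le (L := L) n z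
  have h := differentiable_integral_exp_mul ((Measure.pi fun _ : Fin (n + 1) => configMeasure SU2 L).prod (gaugeMeasure L))
    (measurable_sectorExponent (L := L) n z) hB
  have hfun : (fun b : ℝ => sectorWeight (L := L) b n z (fun _ _ => (1 : ℝ))) =
      fun b : ℝ => ∫ p : (Fin (n + 1) → GaugeConfig 3 L SU2) × (Site 3 L → SU2),
        Real.exp (b * Real.log ((∏ i : Fin n, transferKernel su2Rep 1 (p.1 i.castSucc) (p.1 i.succ)) *
          transferKernel su2Rep 1 (p.1 (Fin.last n)) (gaugeTransform p.2 (twist3 z (p.1 0)))))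
        ∂((Measure.pi fun _ : Fin (n + 1) => configMeasure SU2 L).prod (gaugeMeasure L)) :=
    funext fun b => sectorWeight_one_eq_integral_exp b n z
  rw [hfun]
  exact h

/-- ★ **The sector weights are strictly positive.** [cite: MontvayMunster1994, (3.145)] -/
theorem sectorWeight_one_pos (b : ℝ) (n : ℕ) (z : Fin 3 → Bool) :
    0 < sectorWeight (L := L) b n z (fun _ _ => (1 : ℝ)) := by
  haveI := isProbabilityMeasure_gaugeMeasure (L := L)
  obtain ⟨B, hB⟩ := exists_abs_sectorExponent_le (L := L) n z
  rw [sectorWeight_one_eq_integral_exp]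
  exact integral_exp_mul_pos _ (measurable_sectorExponent (L := L) n z) hB b

end Sector

end Summit.QuantumFields.YangMills.Theorems.FemtoTransferGap.TT.SectorSmooth

/-! ## §4 The item, by name -/

namespace Summit.QuantumFields.YangMills.Theorems

open Summit.QuantumFields.YangMills.Theorems.FemtoTransferGap.TT.SectorSmooth

/-- ★★ **`SectorWeightSmooth` holds** (item stmt-QuantumFields-24143 of route `VirialFluxGap`, BY NAME): for every `L`, `n`, `z` the sector weight
`b ↦ TT.sectorWeight b n z 1` is differentiable on `ℝ` and strictly positive.  No crux / rung / summit is proved; the YM mass gap is NOT proved.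
[cite: MontvayMunster1994, (3.145)] [cite: Luscher1983, §2] -/
theorem virialFluxGap_sectorWeightSmooth_proof :
    Summit.QuantumFields.YangMills.Theses.VirialFluxGap.SectorWeightSmooth := by
  intro L _ n z
  exact ⟨differentiable_sectorWeight_one n z, fun b => sectorWeight_one_pos b n z⟩

end Summit.QuantumFields.YangMills.Theorems

end
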